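import Summits.ABC.ABC.Theses.DefiniteXi
import Literature.NumberTheory.EllipticCurves.ModularCurve
import Literature.NumberTheory.EllipticCurves.ModularParametrizationDegree
import Literature.NumberTheory.EllipticCurves.ModularParametrizationTrustBaseProofs
import Literature.NumberTheory.EllipticCurves.RealLatticePeriod
import Literature.NumberTheory.EllipticCurves.VariableChangePointsMap
import Literature.NumberTheory.EllipticCurves.LFunctionSmulProofs
import Literature.NumberTheory.EllipticCurves.TorsionCardinality
import Literature.NumberTheory.EllipticCurves.GlobalMinimalModelProofs
import Literature.NumberTheory.EllipticCurves.SzpiroOfAbcProofs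
import Literature.NumberTheory.EllipticCurves.Szpiro
import HarnessLib

/-!
# Route DefiniteXi, item `FreyModularity` (stmt-ABC-11340): transport of modular
parametrisation data along a change of variables, and `FreyModularity` from modularity

`FreyModularity` (the existence half of Frey's degree conjecture in datum form: every Frey curve
`E_(a,b) = freyCurve a b` carries a `ModularParametrizationData` at its conductor level) is the
Modularity Theorem (Wiles 1995; Breuil–Conrad–Diamond–Taylor 2001, Thm. A; level = conductor by
Carayol 1986) for the (possibly non-minimal) Frey model. The tree holds modularity as the named fact
`Literature.NumberTheory.EllipticCurves.ModularForms.nonempty_modularParametrizationData`, stated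
for *globally minimal* models. This file proves, unconditionally, the transport of parametrisation
data along an arbitrary admissible change of variables over `ℚ`
(`nonempty_modularParametrizationData_of_smul`), and deduces
`nonempty_modularParametrizationData → FreyModularity`
(`freyModularity_of_nonempty_modularParametrizationData`).

## The transport (Silverman AEC III.1 Table 3.1, VI.5; Cremona §2.10)

Let `D` be a datum for `W' = C • W` at level `N` (`C = (u, r, s, t)` over `ℚ`, `u = p/q` in lowest
terms): newform `f`, lattice `Λ'`, uniformisation `ψ' : ℂ → W'(ℂ)`, Manin constant `c'`
(`c' Λ_f ⊆ Λ'`), degree `d'`. Then `W` carries the datum: the same `f`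
(`L(C • W, s) = L(W, s)`, `WeierstrassCurve.LFunction_smul`), the lattice `Λ = u⁻¹ Λ'`
(`ω_W = u⁻¹ ω_{W'}`), the uniformisation `z ↦ ι⁻¹(ψ'(u z))` with `ι : W(ℂ) ≃ W'(ℂ)` the substitution
on points (`VariableChange.pointEquivBaseChange`; the `℘`-normalisation is checked with the
homogeneity `℘_{u⁻¹Λ'}(z) = u² ℘_{Λ'}(uz)`), the Manin constant `c = q c'`
(`u c Λ_f = p c' Λ_f ⊆ p Λ' ⊆ Λ'`), and the degree `d = p² d'`: the new parametrisation is
`ι⁻¹ ∘ [p] ∘ φ'`, and every fibre of `[p]` on `W'(ℂ) ≅ ℂ/Λ'` has exactly `p²` points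
(`WeierstrassCurve.card_torsionBy_eq_sq`, Silverman AEC III.6.4(b)), so off the finite set
`[p](S')` (`S'` the exceptional set of `φ'`) the fibres of the new parametrisation on `Y₀(N)`
consist of exactly `p² d'` orbits.
-/

-- `Summit.<Summit>.<Problem>` is the mandated summit-side namespace (CONVENTIONS §2); for the
-- single-conjunct summit `ABC` the two coincide, so the duplicate `ABC.ABC` is deliberate.
set_option linter.dupNamespace false

noncomputable section

open scoped MatrixGroups ModularForm

open CongruenceSubgroup UpperHalfPlane Complex
open Literature.NumberTheory.EllipticCurves
open Literature.NumberTheory.EllipticCurves.ModularForms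

namespace Summit.ABC.ABC.Theorems

/-! ### The parametrisation descended to `Y₀(N)` and the fibres of `[m] ∘ φ` -/

section Fibres

variable {V : WeierstrassCurve ℚ} {N : ℕ} [NeZero N]

/-- The modular parametrisation descends to `Y₀(N)`: there is `g : Y₀(N) → W(ℂ)` with
`g(Γ₀(N)τ) = φ(τ)` (a chosen representative; well defined by
`ModularParametrizationData.φ_eq_of_mk_eq_mk_holds'`, Shimura Thm. 7.14). [folklore] -/
theorem exists_descent (D : ModularParametrizationData V N) :
    ∃ g : Y0 N → (V.baseChange ℂ).toAffine.Point, ∀ τ : ℍ, g (Y0.mk N τ) = D.φ τ :=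
  ⟨fun y ↦ D.φ (Classical.choose (Y0.mk_surjective N y)),
    fun τ ↦ D.φ_eq_of_mk_eq_mk_holds' (Classical.choose_spec (Y0.mk_surjective N (Y0.mk N τ)))⟩

/-- The fibre count of the structure field `deg_spec`, rewritten through a descent `g` of `φ` to
`Y₀(N)`: for every `m : ℤ` and `R`, the orbits `y` with `m • φ(τ) = R` for some (equivalently any)
`τ` over `y` are the points of `g ⁻¹' {Q | m • Q = R}`. [folklore] -/
theorem natCard_fibre_eq (D : ModularParametrizationData V N)
    {g : Y0 N → (V.baseChange ℂ).toAffine.Point}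
    (hg : ∀ τ : ℍ, g (Y0.mk N τ) = D.φ τ) (m : ℤ) (R : (V.baseChange ℂ).toAffine.Point) :
    Nat.card {y : Y0 N // ∃ τ : ℍ, Y0.mk N τ = y ∧ m • D.φ τ = R} =
      Nat.card {y : Y0 N // m • g y = R} := by
  refine Nat.card_congr (Equiv.subtypeEquivRight fun y ↦ ⟨?_, fun h ↦ ?_⟩)
  · rintro ⟨τ, rfl, h⟩
    rwa [hg]
  · refine ⟨Classical.choose (Y0.mk_surjective N y), Classical.choose_spec (Y0.mk_surjective N y),
      ?_⟩
    rw [← hg, Classical.choose_spec (Y0.mk_surjective N y)]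
    exact h

/-- The case `m = 1` of `natCard_fibre_eq`: the fibre of `φ` over `Q` on `Y₀(N)` is `g ⁻¹' {Q}`.
[folklore] -/
theorem natCard_fibre_eq_one (D : ModularParametrizationData V N)
    {g : Y0 N → (V.baseChange ℂ).toAffine.Point}
    (hg : ∀ τ : ℍ, g (Y0.mk N τ) = D.φ τ) (Q : (V.baseChange ℂ).toAffine.Point) :
    Nat.card {y : Y0 N // ∃ τ : ℍ, Y0.mk N τ = y ∧ D.φ τ = Q} =
      Nat.card {y : Y0 N // g y = Q} := by
  have h := natCard_fibre_eq D hg 1 Q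
  simpa only [one_zsmul] using h

variable [V.IsElliptic]

/-- Every fibre of multiplication by a nonzero integer `m` on `W(ℂ)` has exactly `m²` points: it is
non-empty because `W(ℂ) = ψ(ℂ)` is divisible (`ψ` the uniformisation of the datum), hence a coset
of the `m`-torsion, which has `m²` elements (Silverman AEC III.6.4(b), the tree's
`WeierstrassCurve.card_torsionBy_eq_sq`). [cite: SilvermanAEC2009, Cor. III.6.4(b)] -/
theorem natCard_zsmul_eq (D : ModularParametrizationData V N) (m : ℤ) (hm : m ≠ 0)
    (R : (V.baseChange ℂ).toAffine.Point) :
    Nat.card {Q : (V.baseChange ℂ).toAffine.Point // m • Q = R} = m.natAbs ^ 2 := by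
  -- a point `Q₀` with `m • Q₀ = R`, from the uniformisation
  obtain ⟨z, rfl⟩ := D.uniformize_surjective R
  set Q₀ : (V.baseChange ℂ).toAffine.Point := D.uniformize (z / m) with hQ₀
  have hmQ₀ : m • Q₀ = D.uniformize z := by
    rw [hQ₀, ← map_zsmul, zsmul_eq_mul, mul_div_cancel₀ _ (Int.cast_ne_zero.mpr hm)]
  -- `m`-torsion is `|m|`-torsion
  have habs : ∀ X : (V.baseChange ℂ).toAffine.Point, (m.natAbs : ℤ) • X = 0 ↔ m • X = 0 := by
    intro X
    rcases Int.natAbs_eq m with hm' | hm'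
    · rw [← hm']
    · conv_rhs => rw [hm']
      rw [neg_zsmul, neg_eq_zero]
  -- the fibre is the coset `Q₀ + W(ℂ)[m]`
  have e : {Q : (V.baseChange ℂ).toAffine.Point // m • Q = D.uniformize z} ≃
      AddSubgroup.torsionBy (V.baseChange ℂ).toAffine.Point (m.natAbs : ℤ) :=
    { toFun := fun Q ↦ ⟨Q.1 - Q₀, (habs _).mpr (by rw [zsmul_sub, Q.2, hmQ₀, sub_self])⟩
      invFun := fun P ↦ ⟨P.1 + Q₀, by
        have h : (m.natAbs : ℤ) • P.1 = 0 := P.2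
        rw [zsmul_add, (habs _).mp h, hmQ₀, zero_add]⟩
      left_inv := fun Q ↦ by ext; exact sub_add_cancel _ _
      right_inv := fun P ↦ by ext; exact add_sub_cancel_right _ _ }
  rw [Nat.card_congr e]
  exact WeierstrassCurve.card_torsionBy_eq_sq (E := V.baseChange ℂ)
    (Nat.cast_ne_zero.mpr (Int.natAbs_ne_zero.mpr hm))

/-- **Fibres of `[m] ∘ φ`.** If `φ : Y₀(N) → W(ℂ)` has fibres of exactly `deg` orbits off a finite
set `S` (the field `deg_spec`), then for a nonzero integer `m` the map `Γ₀(N)τ ↦ m • φ(τ)` has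
fibres of exactly `m² · deg` orbits off the finite set `[m](S)`: the fibre over `R` is the disjoint
union of the fibres of `φ` over the `m²` points `Q` with `m • Q = R`. [folklore] -/
theorem finite_setOf_natCard_fibre_zsmul_ne (D : ModularParametrizationData V N) (m : ℤ)
    (hm : m ≠ 0) :
    {R : (V.baseChange ℂ).toAffine.Point |
      Nat.card {y : Y0 N // ∃ τ : ℍ, Y0.mk N τ = y ∧ m • D.φ τ = R} ≠
        m.natAbs ^ 2 * D.deg}.Finite := by
  obtain ⟨g, hg⟩ := exists_descent D
  -- the exceptional set of `φ`, through `g`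
  have hS : {Q : (V.baseChange ℂ).toAffine.Point |
      Nat.card {y : Y0 N // g y = Q} ≠ D.deg}.Finite := by
    refine D.deg_spec.subset fun Q hQ ↦ ?_
    have hQ' : Nat.card {y : Y0 N // g y = Q} ≠ D.deg := hQ
    change Nat.card {y : Y0 N // ∃ τ : ℍ, Y0.mk N τ = y ∧ D.φ τ = Q} ≠ D.deg
    rwa [natCard_fibre_eq_one D hg]
  refine (hS.image fun Q ↦ m • Q).subset fun R hR ↦ ?_
  -- contrapositive: if every `Q` over `R` is a good value of `φ`, the fibre over `R` consists of
  -- `m² · deg` orbits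
  by_contra hR'
  apply hR
  have hgood : ∀ Q : (V.baseChange ℂ).toAffine.Point, m • Q = R →
      Nat.card {y : Y0 N // g y = Q} = D.deg := by
    intro Q hQ
    by_contra hQ'
    exact hR' ⟨Q, hQ', hQ⟩
  rw [natCard_fibre_eq D hg]
  -- decompose the fibre over `R` along the `m²` points `Q` with `m • Q = R`
  have hT := natCard_zsmul_eq D m hm R
  haveI : Finite {Q : (V.baseChange ℂ).toAffine.Point // m • Q = R} :=
    Nat.finite_of_card_ne_zero (by rw [hT]; exact pow_ne_zero _ (Int.natAbs_ne_zero.mpr hm))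
  letI : Fintype {Q : (V.baseChange ℂ).toAffine.Point // m • Q = R} := Fintype.ofFinite _
  haveI : ∀ Q : {Q : (V.baseChange ℂ).toAffine.Point // m • Q = R},
      Finite {y : Y0 N // g y = Q.1} := fun Q ↦
    Nat.finite_of_card_ne_zero (by rw [hgood Q.1 Q.2]; exact D.deg_pos.ne')
  rw [← Nat.card_congr (Equiv.sigmaSubtypeFiberEquivSubtype g
    (p := fun y ↦ m • g y = R) (q := fun Q ↦ m • Q = R) fun _ ↦ Iff.rfl),
    Nat.card_sigma, Finset.sum_congr rfl fun Q _ ↦ hgood Q.1 Q.2, Finset.sum_const,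
    Finset.card_univ, smul_eq_mul, ← Nat.card_eq_fintype_card, hT]

end Fibres

/-! ### Transport of parametrisation data along a change of variables -/

section Smul

variable {W : WeierstrassCurve ℚ} [W.IsElliptic] (C : WeierstrassCurve.VariableChange ℚ)
  {N : ℕ} [NeZero N]

/-- **Transport of modular parametrisation data along a change of variables.** If `C • W` carries
a modular parametrisation datum at level `N` (`C = (u, r, s, t)` an admissible change of variables
over `ℚ`, `u = p/q` in lowest terms), then so does `W`: same newform (`L(C • W, s) = L(W, s)`),
lattice `u⁻¹Λ'` (`ω_W = u⁻¹ω_{C • W}`, Silverman AEC III.1 Table 3.1), uniformisation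
`z ↦ ι⁻¹(ψ'(uz))` through the substitution `ι : W(ℂ) ≃ (C • W)(ℂ)` on points, Manin constant
`q c'` and degree `p² d'` (the new parametrisation is `ι⁻¹ ∘ [p] ∘ φ'`, and `[p]` has fibres of
`p²` points on `(C • W)(ℂ)`). [cite: SilvermanAEC2009, III.1 Table 3.1 and Cor. III.6.4(b)] -/
theorem nonempty_modularParametrizationData_of_smul
    (h : Nonempty (ModularParametrizationData (C • W) N)) :
    Nonempty (ModularParametrizationData W N) := by
  obtain ⟨D⟩ := h
  -- notation
  set u : ℚ := (C.u : ℚ) with hu_def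
  have hu : u ≠ 0 := C.u.ne_zero
  have huC : (u : ℂ) ≠ 0 := by exact_mod_cast hu
  have huCi : (u : ℂ)⁻¹ ≠ 0 := inv_ne_zero huC
  set Cc : WeierstrassCurve.VariableChange ℂ := C.map (algebraMap ℚ ℂ) with hCc_def
  have hCcu : ((Cc.u : ℂˣ) : ℂ) = (u : ℂ) := by
    simp [hCc_def, WeierstrassCurve.VariableChange.map_u, hu_def]
  have hCcui : ((Cc.u⁻¹ : ℂˣ) : ℂ) = (u : ℂ)⁻¹ := by
    rw [Units.val_inv_eq_inv_val, hCcu]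
  have hCcr : Cc.r = (C.r : ℂ) := by simp [hCc_def]
  have hCcs : Cc.s = (C.s : ℂ) := by simp [hCc_def]
  have hCct : Cc.t = (C.t : ℂ) := by simp [hCc_def]
  have hsmul : (C • W).baseChange ℂ = Cc • W.baseChange ℂ :=
    WeierstrassCurve.VariableChange.baseChange_smul_eq W C ℂ
  -- the substitution on points
  set ι : (W.baseChange ℂ).toAffine.Point ≃+ ((C • W).baseChange ℂ).toAffine.Point :=
    WeierstrassCurve.VariableChange.pointEquivBaseChange W C ℂ with hι_def
  -- the lattice `u⁻¹ Λ'`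
  set L : PeriodPair := D.L.mulLeft (u : ℂ)⁻¹ huCi with hL_def
  have hmemL : ∀ z : ℂ, z ∈ L.lattice ↔ (u : ℂ) * z ∈ D.L.lattice := fun z ↦ by
    rw [hL_def, PeriodPair.mem_mulLeft_lattice, inv_inv]
  -- the uniformisation `z ↦ ι⁻¹ (ψ' (u z))`
  set ψ : ℂ →+ (W.baseChange ℂ).toAffine.Point :=
    ι.symm.toAddMonoidHom.comp (D.uniformize.comp (AddMonoidHom.mulLeft (u : ℂ))) with hψ_def
  have hψ : ∀ z, ψ z = ι.symm (D.uniformize ((u : ℂ) * z)) := fun z ↦ rfl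
  -- numerator and denominator of `u`
  have hnum : ((u.num : ℤ) : ℂ) = (u : ℂ) * (u.den : ℂ) := by
    have h := Rat.den_mul_eq_num u
    have h' : ((u.den : ℚ) : ℂ) * ((u : ℚ) : ℂ) = ((u.num : ℚ) : ℂ) := by
      rw [← Rat.cast_mul, h]
    rw [mul_comm]
    simpa using h'.symm
  have hnum0 : u.num ≠ 0 := Rat.num_ne_zero.mpr hu
  refine ⟨{
    f := D.f
    isNewformOf := ⟨D.isNewformOf.1, fun n ↦ by
      rw [D.isNewformOf.2 n, WeierstrassCurve.LFunction_smul]⟩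
    L := L
    isNeronLattice := ?_
    uniformize := ψ
    ker_uniformize := ?_
    uniformize_surjective := ?_
    uniformize_spec := ?_
    c := (u.den : ℤ) * D.c
    smul_periodLattice_le := ?_
    deg := u.num.natAbs ^ 2 * D.deg
    deg_pos := Nat.mul_pos (pow_pos (Int.natAbs_pos.mpr hnum0) 2) D.deg_pos
    deg_spec := ?_ }⟩
  · -- `g₂(u⁻¹Λ') = u⁴ g₂(Λ') = c₄(W)/12`, `g₃(u⁻¹Λ') = u⁶ g₃(Λ') = c₆(W)/216`
    obtain ⟨h₂, h₃⟩ := D.isNeronLattice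
    constructor
    · rw [hL_def, PeriodPair.g₂_mulLeft, h₂, WeierstrassCurve.baseChange, WeierstrassCurve.map_c₄,
        WeierstrassCurve.variableChange_c₄, WeierstrassCurve.baseChange, WeierstrassCurve.map_c₄]
      simp only [map_mul, map_pow, Units.val_inv_eq_inv_val, map_inv₀, eq_ratCast, inv_pow,
        inv_inv]
      rw [← hu_def]
      field_simp
    · rw [hL_def, PeriodPair.g₃_mulLeft, h₃, WeierstrassCurve.baseChange, WeierstrassCurve.map_c₆,
        WeierstrassCurve.variableChange_c₆, WeierstrassCurve.baseChange, WeierstrassCurve.map_c₆]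
      simp only [map_mul, map_pow, Units.val_inv_eq_inv_val, map_inv₀, eq_ratCast, inv_pow,
        inv_inv]
      rw [← hu_def]
      field_simp
  · -- kernel `= u⁻¹ Λ'`
    ext z
    rw [SetLike.mem_coe, AddMonoidHom.mem_ker, hψ, AddEquiv.map_eq_zero_iff,
      D.uniformize_eq_zero_iff, SetLike.mem_coe, hmemL]
  · -- surjective
    intro P
    obtain ⟨w, hw⟩ := D.uniformize_surjective (ι P)
    refine ⟨(u : ℂ)⁻¹ * w, ?_⟩
    rw [hψ, ← mul_assoc, mul_inv_cancel₀ huC, one_mul, hw, AddEquiv.symm_apply_apply]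
  · -- the `℘`-normalisation
    intro z hz
    have hz' : (u : ℂ) * z ∉ D.L.lattice := fun h ↦ hz ((hmemL z).mpr h)
    obtain ⟨h', hspec⟩ := D.uniformize_spec ((u : ℂ) * z) hz'
    -- homogeneity of `℘`, `℘'`
    have hP : L.weierstrassP z = (u : ℂ) ^ 2 * D.L.weierstrassP ((u : ℂ) * z) := by
      have h := PeriodPair.weierstrassP_mulLeft (u : ℂ)⁻¹ huCi D.L ((u : ℂ) * z)
      rw [← mul_assoc, inv_mul_cancel₀ huC, one_mul, inv_pow, inv_inv] at h
      rw [hL_def, h]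
    have hP' : L.derivWeierstrassP z = (u : ℂ) ^ 3 * D.L.derivWeierstrassP ((u : ℂ) * z) := by
      have h := PeriodPair.derivWeierstrassP_mulLeft (u : ℂ)⁻¹ huCi D.L ((u : ℂ) * z)
      rw [← mul_assoc, inv_mul_cancel₀ huC, one_mul, inv_pow, inv_inv] at h
      rw [hL_def, h]
    -- the coefficients of `C • W` over `ℂ`
    have hb₂ : ((C • W).baseChange ℂ).b₂ =
        (u : ℂ)⁻¹ ^ 2 * ((W.baseChange ℂ).b₂ + 12 * (C.r : ℂ)) := by
      rw [hsmul, WeierstrassCurve.variableChange_b₂, hCcui, hCcr]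
    have ha₁ : ((C • W).baseChange ℂ).a₁ = (u : ℂ)⁻¹ * ((W.baseChange ℂ).a₁ + 2 * (C.s : ℂ)) := by
      rw [hsmul, WeierstrassCurve.variableChange_a₁, hCcui, hCcs]
    have ha₃ : ((C • W).baseChange ℂ).a₃ = (u : ℂ)⁻¹ ^ 3 *
        ((W.baseChange ℂ).a₃ + (C.r : ℂ) * (W.baseChange ℂ).a₁ + 2 * (C.t : ℂ)) := by
      rw [hsmul, WeierstrassCurve.variableChange_a₃, hCcui, hCcr, hCct]
    -- the new coordinates of the target point are the coordinates of `ψ'(uz)`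
    set X : ℂ := L.weierstrassP z - (W.baseChange ℂ).b₂ / 12 with hX
    set Y : ℂ := (L.derivWeierstrassP z - (W.baseChange ℂ).a₁ * (L.weierstrassP z -
      (W.baseChange ℂ).b₂ / 12) - (W.baseChange ℂ).a₃) / 2 with hY
    have hx : Cc.toX X = D.L.weierstrassP ((u : ℂ) * z) - ((C • W).baseChange ℂ).b₂ / 12 := by
      rw [WeierstrassCurve.VariableChange.toX_def, hCcui, hCcr, hX, hP, hb₂]
      field_simp
      ring
    have hy : Cc.toY X Y = (D.L.derivWeierstrassP ((u : ℂ) * z) -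
        ((C • W).baseChange ℂ).a₁ * (D.L.weierstrassP ((u : ℂ) * z) -
          ((C • W).baseChange ℂ).b₂ / 12) - ((C • W).baseChange ℂ).a₃) / 2 := by
      rw [WeierstrassCurve.VariableChange.toY_def, hCcui, hCcr, hCcs, hCct, hX, hY, hP, hP', hb₂,
        ha₁, ha₃]
      field_simp
      ring
    -- nonsingularity of the target point, transported back along the substitution
    have h₀ : (W.baseChange ℂ).toAffine.Nonsingular X Y := by
      rw [← WeierstrassCurve.VariableChange.nonsingular_iff (W.baseChange ℂ) Cc X Y, hx, hy,
        ← hsmul]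
      exact h'
    refine ⟨h₀, ?_⟩
    rw [hψ, AddEquiv.symm_apply_eq, hspec, hι_def,
      WeierstrassCurve.VariableChange.pointEquivBaseChange_some]
    simp only [← hCc_def, hx, hy]
  · -- `u · (q c') Λ_f = p c' Λ_f ⊆ p Λ' ⊆ Λ'`
    intro z hz
    rw [hmemL, Int.cast_mul, Int.cast_natCast, ← mul_assoc, ← mul_assoc, ← hnum, mul_assoc,
      ← zsmul_eq_mul]
    exact D.L.lattice.smul_mem u.num (D.smul_periodLattice_le z hz)
  · -- the fibre count: the new parametrisation is `ι⁻¹ ∘ [p] ∘ φ'`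
    have hφ : ∀ τ : ℍ, ψ ((((u.den : ℤ) * D.c : ℤ) : ℂ) * eichlerIntegral D.f τ) =
        ι.symm (u.num • D.φ τ) := fun τ ↦ by
      rw [hψ, Int.cast_mul, Int.cast_natCast, ← mul_assoc, ← mul_assoc, ← hnum, mul_assoc,
        ← zsmul_eq_mul, map_zsmul]
      rfl
    have hfin := finite_setOf_natCard_fibre_zsmul_ne D u.num hnum0
    refine (hfin.preimage ι.injective.injOn).subset fun P hP ↦ ?_
    simp only [Set.mem_preimage, Set.mem_setOf_eq]
    simp only [Set.mem_setOf_eq, hφ] at hP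
    convert hP using 4 with y
    refine exists_congr fun τ ↦ and_congr Iff.rfl ?_
    rw [AddEquiv.symm_apply_eq]

end Smul

/-! ### `FreyModularity` from modularity -/

/-- **`FreyModularity` from the Modularity Theorem** (Wiles 1995; Breuil–Conrad–Diamond–Taylor
2001, Thm. A; level = conductor by Carayol 1986; in the tree the named fact
`nonempty_modularParametrizationData`, stated for globally minimal models): the Frey model
`E_(a,b) : y² = x(x − a)(x + b)` (elliptic for `ab(a+b) ≠ 0`) has a globally minimal model
`C • E_(a,b)` (`WeierstrassCurve.hasGlobalMinimalModel_rat_holds`, Néron; Silverman AEC VIII.8.3)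
of the same conductor (`WeierstrassCurve.conductorNorm_smul_rat`), whose datum is transported back
along `C` (`nonempty_modularParametrizationData_of_smul`). This is the conditional `--supports`
lemma asked for by item stmt-ABC-11340; the item itself closes only with modularity.
[cite: BCDTJAMS2001, Thm. A] -/
theorem freyModularity_of_nonempty_modularParametrizationData
    (hmod : nonempty_modularParametrizationData) :
    Summit.ABC.ABC.Theses.DefiniteXi.FreyModularity := by
  intro a b _ h0 N _ hN
  haveI := isElliptic_freyCurve h0
  obtain ⟨C, hC⟩ := WeierstrassCurve.hasGlobalMinimalModel_rat_holds (freyCurve a b)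
  have hN' : (C • freyCurve a b).conductorNorm ℤ = N := by
    rw [WeierstrassCurve.conductorNorm_smul_rat, hN]
  subst hN'
  exact nonempty_modularParametrizationData_of_smul C (hmod (C • freyCurve a b))

/-- **`FreyModularity` on the exact residual trust base of the tree's modularity fact.**
Modularity "Version `a_p`" (`exists_isNewformOf`: Breuil–Conrad–Diamond–Taylor 2001, Thm. A in
the form (2), with Carayol's level) and the commensurability of `Λ_f` and `Λ_E`
(`IsNewformOf.exists_maninConstant_ne_zero`: Eichler–Shimura with Faltings' isogeny theorem) give
`FreyModularity`, through `nonempty_modularParametrizationData_of_exists_isNewformOf`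
(`ModularParametrizationTrustBaseProofs.lean`, whose `nonempty_modularParametrizationData_iff`
shows that these two named facts are also necessary for the modularity fact itself). This names
the two undischarged Literature facts the item stmt-ABC-11340 ultimately rests on.
[cite: BCDTJAMS2001, Thm. A] -/
theorem freyModularity_of_exists_isNewformOf (h₁ : exists_isNewformOf)
    (ha : IsNewformOf.exists_maninConstant_ne_zero) :
    Summit.ABC.ABC.Theses.DefiniteXi.FreyModularity :=
  freyModularity_of_nonempty_modularParametrizationData
    (nonempty_modularParametrizationData_of_exists_isNewformOf h₁ ha)

section SmulIff

variable {W : WeierstrassCurve ℚ} [W.IsElliptic] (C : WeierstrassCurve.VariableChange ℚ)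
  {N : ℕ} [NeZero N]

/-- Existence of modular parametrisation data at level `N` is invariant under admissible changes
of variables over `ℚ` (both directions of `nonempty_modularParametrizationData_of_smul`, the
converse through `C⁻¹ • (C • W) = W`). [folklore] -/
theorem nonempty_modularParametrizationData_smul_iff :
    Nonempty (ModularParametrizationData (C • W) N) ↔
      Nonempty (ModularParametrizationData W N) :=
  ⟨nonempty_modularParametrizationData_of_smul C, fun h ↦
    nonempty_modularParametrizationData_of_smul C⁻¹ (by rwa [inv_smul_smul])⟩

end SmulIff

end Summit.ABC.ABC.Theorems

end
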